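import Summits.RiemannHypothesis.RiemannHypothesis.Theorems.SemilocalPiecewiseWitness
import HarnessLib

/-!
# Semi-local thresholds, negative side (IVc): PIECEWISE polynomial Markov witnesses, part 2 — the increment on `t`-pieces

Cell `rh-explicit` (HOME `run/shared/lean/pub/rh-explicit/`), seat cc-s2-4 gen8 (kernel column of the A4 SEMILOCAL-TABLE; third file of
the PIECEWISE-witness layer of `HOME/cc-s2-4/CC4-LEAN.md` §13.6).  Honest framing: bookkeeping; nothing here bears on RH.  No data trusted.

For the odd piecewise witness `G(x) = F(x) − F(−x)`, `F = Σ_k 1_{[lo_k,hi_k]}·p_k` (`SemilocalPiecewiseWitness.lean`), the increment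
`D(t) = ∫ |G(x+t) − G(x)|² dx` is, for `t ≥ 0`, `2‖G‖² − 2A(t)` with `A(t) = ∫ G(x+t)G(x) dx = 2∫F(x+t)F(x) dx − 2∫F(x+t)F(−x) dx`
(`integral_pwG_shift_mul`), and `F(−x) = pwF (pwMirror P) x` exactly.  Each cross term
`∫ 1_{I}(x+t) p(x+t) · 1_{J}(x) q(x) dx = ∫_{max(lo_J, lo_I − t)}^{min(hi_J, hi_I − t)} p(x+t) q(x) dx`
is, on every `t`-interval `[T₀, T₁]` on which the `max`/`min` selections do not switch and the integration range does not change sign, the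
EXISTING rational list `LQ.intB (mulUB q (shiftB p)) L U` (`SemilocalListPoly.lean`) with `L, U ∈ {[lo_J], [lo_I, −1], [hi_J], [hi_I, −1]}`
— or `0`.  The selection is COMPUTED (`crossTermL`, an `Option (List ℚ)`: `none` when `[T₀, T₁]` straddles a switch point, which a
generator avoids by cutting at all pairwise endpoint differences), so that the whole increment on the piece is one computed list (part 2b, `SemilocalPiecewiseIncrementSum.lean`: `pwIncrementL`,
`weilIncrement_pwWitness_eq`).  This file (part 2a): the mirror pieces, the limit selections and ONE cross term (`integral_cross_eq`).
Folklore throughout.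
-/

set_option autoImplicit false
set_option linter.dupNamespace false  -- the mandated namespace repeats `RiemannHypothesis`

noncomputable section

open Complex Filter Set MeasureTheory Topology
open scoped Real

namespace Summit.RiemannHypothesis.RiemannHypothesis.Theorems.SemilocalPolyWitness

open MeasureTheory Set Finset Real
open Literature.NumberTheory.LFunctions
open Summit.RiemannHypothesis.RiemannHypothesis.Theorems.MotivicDoor
open LQ

/-! ## Mirror pieces: `F(−x)` as a piecewise polynomial -/

/-- Coefficients of `p(−x)`: alternate the signs. -/
def reflectL : List ℚ → List ℚ
  | [] => []
  | a :: as => a :: smul (-1) (reflectL as)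

/-- `ev (reflectL p) x = ev p (−x)`. -/
theorem ev_reflectL : ∀ (p : List ℚ) (x : ℝ), ev (reflectL p) x = ev p (-x)
  | [], x => by simp [reflectL]
  | a :: as, x => by
      rw [reflectL, ev_cons, ev_smul, ev_reflectL as x, ev_cons]
      push_cast
      ring

/-- The mirror piece `(−hi, −lo, p(−x))`. -/
def Pw.mirror (pc : Pw) : Pw := ⟨-pc.hi, -pc.lo, reflectL pc.p⟩

/-- The mirror list. -/
def pwMirror (P : List Pw) : List Pw := P.map Pw.mirror

/-- One mirrored piece evaluates to the original at `−x`. -/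
theorem indicator_mirror (pc : Pw) (x : ℝ) :
    (Icc ((pc.mirror.lo : ℚ) : ℝ) pc.mirror.hi).indicator (ev pc.mirror.p) x =
      (Icc (pc.lo : ℝ) pc.hi).indicator (ev pc.p) (-x) := by
  simp only [Pw.mirror]
  push_cast
  by_cases hx : x ∈ Icc (-(pc.hi : ℝ)) (-(pc.lo : ℝ))
  · have hx' : -x ∈ Icc (pc.lo : ℝ) pc.hi := by
      rw [Set.mem_Icc] at hx ⊢; constructor <;> linarith [hx.1, hx.2]
    rw [indicator_of_mem hx, indicator_of_mem hx', ev_reflectL]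
  · have hx' : -x ∉ Icc (pc.lo : ℝ) pc.hi := fun h ↦ hx (by
      rw [Set.mem_Icc] at h ⊢; constructor <;> linarith [h.1, h.2])
    rw [indicator_of_notMem hx, indicator_of_notMem hx']

/-- **`F(−x) = pwF (pwMirror P) x`.** -/
theorem pwF_neg : ∀ (P : List Pw) (x : ℝ), pwF P (-x) = pwF (pwMirror P) x
  | [], x => rfl
  | pc :: P, x => by
      simp only [pwF, pwMirror, List.map_cons]
      rw [indicator_mirror, pwF_neg P x]
      rfl

/-! ## One cross term on a `t`-piece -/

/-- The selected lower limit on `[T₀, T₁]`: `max(lo_J, lo_I − t)` as a list, if the selection does not switch. -/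
def selLowerL (I J : Pw) (T0 T1 : ℚ) : Option (List ℚ) :=
  if I.lo - J.lo ≤ T0 then some [J.lo] else if T1 ≤ I.lo - J.lo then some [I.lo, -1] else none

/-- The selected upper limit on `[T₀, T₁]`: `min(hi_J, hi_I − t)` as a list, if the selection does not switch. -/
def selUpperL (I J : Pw) (T0 T1 : ℚ) : Option (List ℚ) :=
  if T1 ≤ I.hi - J.hi then some [J.hi] else if I.hi - J.hi ≤ T0 then some [I.hi, -1] else none

/-- The cross term `∫ 1_I(x+t) p_I(x+t) · 1_J(x) q_J(x) dx` on `[T₀, T₁]` as a list in `t` (`some []` = identically `0`),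
or `none` if the piece straddles a switch point / a sign change of the range. -/
def crossTermL (I J : Pw) (T0 T1 : ℚ) : Option (List ℚ) :=
  match selLowerL I J T0 T1, selUpperL I J T0 T1 with
  | some L, some U =>
      if evQ L T0 ≤ evQ U T0 ∧ evQ L T1 ≤ evQ U T1 then some (intB (mulUB J.p (shiftB I.p)) L U)
      else if evQ U T0 ≤ evQ L T0 ∧ evQ U T1 ≤ evQ L T1 then some []
      else none
  | _, _ => none

/-- On `[T₀, T₁]` the selected lower list evaluates to `max(lo_J, lo_I − t)`. -/
theorem ev_selLowerL {I J : Pw} {T0 T1 : ℚ} {L : List ℚ} (h : selLowerL I J T0 T1 = some L) {t : ℝ}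
    (ht : t ∈ Icc (T0 : ℝ) T1) : ev L t = max ((I.lo : ℝ) - t) (J.lo : ℝ) := by
  unfold selLowerL at h
  split_ifs at h with h1 h2
  · cases h
    have : ((I.lo - J.lo : ℚ) : ℝ) ≤ T0 := by exact_mod_cast h1
    push_cast at this
    rw [max_eq_right (by linarith [ht.1])]; simp
  · cases h
    have : (T1 : ℝ) ≤ ((I.lo - J.lo : ℚ) : ℝ) := by exact_mod_cast h2
    push_cast at this
    rw [max_eq_left (by linarith [ht.2])]; simp; ring

/-- On `[T₀, T₁]` the selected upper list evaluates to `min(hi_J, hi_I − t)`. -/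
theorem ev_selUpperL {I J : Pw} {T0 T1 : ℚ} {U : List ℚ} (h : selUpperL I J T0 T1 = some U) {t : ℝ}
    (ht : t ∈ Icc (T0 : ℝ) T1) : ev U t = min ((I.hi : ℝ) - t) (J.hi : ℝ) := by
  unfold selUpperL at h
  split_ifs at h with h1 h2
  · cases h
    have : (T1 : ℝ) ≤ ((I.hi - J.hi : ℚ) : ℝ) := by exact_mod_cast h1
    push_cast at this
    rw [min_eq_right (by linarith [ht.2])]; simp
  · cases h
    have : ((I.hi - J.hi : ℚ) : ℝ) ≤ T0 := by exact_mod_cast h2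
    push_cast at this
    rw [min_eq_left (by linarith [ht.1])]; simp; ring

/-- A linear (degree ≤ 1) list that is `≤` another at both ends of `[T₀, T₁]` is `≤` throughout: here in the concrete form
needed, via the values `max/min` being affine on the piece.  We state it for reals directly. -/
theorem affine_le_of_ends {f g : ℝ → ℝ} {a0 a1 c0 c1 : ℝ} (hf : ∀ t, f t = a0 + a1 * t) (hg : ∀ t, g t = c0 + c1 * t)
    {T0 T1 t : ℝ} (h0 : f T0 ≤ g T0) (h1 : f T1 ≤ g T1) (ht : t ∈ Icc T0 T1) : f t ≤ g t := by
  rw [hf, hg] at h0 h1 ⊢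
  rcases eq_or_lt_of_le (ht.1.trans ht.2) with heq | hlt
  · have : t = T0 := le_antisymm (heq ▸ ht.2) ht.1
    rw [this]; exact h0
  · -- t = (1-s) T0 + s T1
    set s := (t - T0) / (T1 - T0) with hs
    have hs0 : 0 ≤ s := div_nonneg (by linarith [ht.1]) (by linarith)
    have hs1 : s ≤ 1 := by rw [hs, div_le_one (by linarith)]; linarith [ht.2]
    have et : t = T0 + s * (T1 - T0) := by rw [hs]; field_simp; ring
    rw [et]
    nlinarith [h0, h1, hs0, hs1]

/-- The pointwise product of the two shifted indicator pieces is the indicator of one closed interval. -/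
theorem indicator_shift_mul (I J : Pw) (t x : ℝ) :
    (Icc (I.lo : ℝ) I.hi).indicator (ev I.p) (x + t) * (Icc (J.lo : ℝ) J.hi).indicator (ev J.p) x =
      (Icc (max ((I.lo : ℝ) - t) (J.lo : ℝ)) (min ((I.hi : ℝ) - t) (J.hi : ℝ))).indicator
        (fun y ↦ ev I.p (y + t) * ev J.p y) x := by
  have e1 : (Icc (I.lo : ℝ) I.hi).indicator (ev I.p) (x + t) =
      (Icc ((I.lo : ℝ) - t) ((I.hi : ℝ) - t)).indicator (fun y ↦ ev I.p (y + t)) x := by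
    by_cases hx : x ∈ Icc ((I.lo : ℝ) - t) ((I.hi : ℝ) - t)
    · have : x + t ∈ Icc (I.lo : ℝ) I.hi := by rw [Set.mem_Icc] at hx ⊢; constructor <;> linarith [hx.1, hx.2]
      rw [indicator_of_mem hx, indicator_of_mem this]
    · have : x + t ∉ Icc (I.lo : ℝ) I.hi := fun h ↦ hx (by rw [Set.mem_Icc] at h ⊢; constructor <;> linarith [h.1, h.2])
      rw [indicator_of_notMem hx, indicator_of_notMem this]
  rw [e1, ← inter_indicator_mul, Set.Icc_inter_Icc]

/-- **One cross term on a valid `t`-piece.** -/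
theorem integral_cross_eq {I J : Pw} {T0 T1 : ℚ} {C : List ℚ} (h : crossTermL I J T0 T1 = some C) {t : ℝ}
    (ht : t ∈ Icc (T0 : ℝ) T1) :
    ∫ x, (Icc (I.lo : ℝ) I.hi).indicator (ev I.p) (x + t) * (Icc (J.lo : ℝ) J.hi).indicator (ev J.p) x = ev C t := by
  simp_rw [indicator_shift_mul I J t]
  rw [integral_indicator measurableSet_Icc]
  unfold crossTermL at h
  -- extract the selections
  cases hL : selLowerL I J T0 T1 with
  | none => simp [hL] at h
  | some L =>
    cases hU : selUpperL I J T0 T1 with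
    | none => simp [hL, hU] at h
    | some U =>
      simp only [hL, hU] at h
      have eL := ev_selLowerL hL ht
      have eU := ev_selUpperL hU ht
      -- affine forms of ev L, ev U (both lists have length ≤ 2)
      have hLaff : ∀ s : ℝ, ev L s = (L.getD 0 0 : ℚ) + (L.getD 1 0 : ℚ) * s := by
        intro s
        unfold selLowerL at hL
        split_ifs at hL <;> cases hL <;> simp
      have hUaff : ∀ s : ℝ, ev U s = (U.getD 0 0 : ℚ) + (U.getD 1 0 : ℚ) * s := by
        intro s
        unfold selUpperL at hU
        split_ifs at hU <;> cases hU <;> simp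
      have hT0 : (T0 : ℝ) ∈ Icc (T0 : ℝ) T1 := ⟨le_rfl, ht.1.trans ht.2⟩
      have hT1 : (T1 : ℝ) ∈ Icc (T0 : ℝ) T1 := ⟨ht.1.trans ht.2, le_rfl⟩
      split_ifs at h with hne hem
      · -- nonempty range throughout: L ≤ U on the piece
        cases h
        have h0 : ev L T0 ≤ ev U T0 := by
          rw [ev_ratCast, ev_ratCast]; exact_mod_cast hne.1
        have h1 : ev L T1 ≤ ev U T1 := by
          rw [ev_ratCast, ev_ratCast]; exact_mod_cast hne.2
        have hLU : ev L t ≤ ev U t := affine_le_of_ends hLaff hUaff h0 h1 ht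
        rw [← eL, ← eU, integral_Icc_eq_integral_Ioc, ← intervalIntegral.integral_of_le hLU]
        have e : ∀ x, ev I.p (x + t) * ev J.p x = evalB (mulUB J.p (shiftB I.p)) x t := fun x ↦ by
          rw [evalB_mulUB, evalB_shiftB]; ring
        simp_rw [e]
        exact integral_evalB _ _ _ _
      · -- empty (or degenerate) range throughout: U ≤ L on the piece
        cases h
        have h0 : ev U T0 ≤ ev L T0 := by
          rw [ev_ratCast, ev_ratCast]; exact_mod_cast hem.1
        have h1 : ev U T1 ≤ ev L T1 := by
          rw [ev_ratCast, ev_ratCast]; exact_mod_cast hem.2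
        have hUL : ev U t ≤ ev L t := affine_le_of_ends hUaff hLaff h0 h1 ht
        have hz : volume (Icc (ev L t) (ev U t)) = 0 := by
          rw [Real.volume_Icc, ENNReal.ofReal_eq_zero]; linarith
        rw [← eL, ← eU, ev_nil, setIntegral_measure_zero _ hz]

end Summit.RiemannHypothesis.RiemannHypothesis.Theorems.SemilocalPolyWitness

end
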